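import Summits.ValiantsHypothesis.ValiantsHypothesis.Theorems.DepthWindowPathBias
import Summits.ValiantsHypothesis.ValiantsHypothesis.Theorems.DepthWindowTreeBiasMono

/-!
# Route `DepthWindow` — path-cost bookkeeping for tree bias (`sibCost`, `pathCost`, `LowPathTree`)

Cone-free helper (decomp-valiant lens 4, g16; step P1–P2 of the `ULPB₂` plan, NODE-v16 §4b/§5.2) supporting the
crux item `HomImmHardTwoOne` (stmt-ValiantsHypothesis-30635).  The node-bias framework of
`DepthWindowLowBiasRound.lean` (`LowBiasTree`, substitution along a grouping) controls LST's tree bias only up to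
a factor `Δ` (`offCost ≤ Σ nodeBias`).  To prove PATH-bias bounds (`¬ TreeBiasGe w Δ (B·h + 1)`, conjecture
`UniversalLowTreeBiasAt`) one needs the exact bookkeeping of LST 2022 Prop. 17:

* `sibCost w T u i` — the `|sums|` of the SIBLINGS of leaf `i`'s level-`(u-1)` block inside its level-`u` block
  (`= nodeBias − |own child block sum|`), and `pathCost w T Δ i = Σ_{u=1}^{Δ} sibCost w T u i`;
* `offCost_eq_nodeBias_add` — the bias of the internal path from the root down to the level-`t` node of `i` is
  EXACTLY `nodeBias (end node) + Σ_{t<u≤Δ} sibCost`, hence `≤ nodeBias + pathCost`;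
* `LowPathTree w Δ β γ` — a depth-`Δ` tree with node biases `≤ β` and per-leaf path costs `≤ γ i`;
  `not_treeBiasGe_of_lowPathTree` — such a tree refutes `TreeBiasGe w Δ' τ` for every `Δ' ≥ Δ` once
  `β + sup γ < τ + |Σ w|`; `LowPathTreesAt C B c₁` (conjecture schema: uniform low-path trees at slope `C`) and
  `universalLowTreeBiasAt_of_lowPathTreesAt` — the resulting `ULPB_C` criterion (`UniversalLowTreeBiasAt C`);
* SUBSTITUTION with budgets (`lowPathTree_succ_of_quotient`): grouping the letters by `c` costs leaf `i` exactly
  `mass(c i) − |w i|` at the new level, and above it the path costs are those of the quotient tree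
  (`pathCost_substitute_succ`) — the per-leaf accumulated-cost recursion used by the `ULPB₂` builder.

References: [LimayeSrinivasanTavenas2022] CCC 2022 Def. 2, Thm. 3; full version Def. 15, Prop. 16–17.
-/

-- layout Summits/ValiantsHypothesis/ValiantsHypothesis forces the duplicated namespace component
set_option linter.dupNamespace false

namespace Summit.ValiantsHypothesis.ValiantsHypothesis.Theorems.DepthWindow.TreeBias

open Finset

variable {d : ℕ}

/-! ### Sibling cost and path cost -/

/-- The **sibling cost** of leaf `i` at level `u ≥ 1`: the sum of `|Sum(v)|` over the children `v` of `i`'s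
level-`u` node other than `i`'s own level-`(u-1)` node; equivalently the node bias minus the own child's `|Sum|`.
[cite: LimayeSrinivasanTavenas2022, Def. 2] -/
def sibCost (w : Fin d → ℤ) (T : LTree d) (u : ℕ) (i : Fin d) : ℤ :=
  nodeBias w T u i - |blockSum w T (u - 1) (T.lab (u - 1) i)|

/-- The own child is one of the children. [folklore] -/
theorem lab_mem_children (T : LTree d) (u : ℕ) (i : Fin d) :
    T.lab (u - 1) i ∈ (univ.filter fun j => T.lab u j = T.lab u i).image (T.lab (u - 1)) :=
  mem_image.2 ⟨i, by simp, rfl⟩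

/-- The sibling cost as a sum over the siblings. [cite: LimayeSrinivasanTavenas2022, Def. 2] -/
theorem sibCost_eq (w : Fin d → ℤ) (T : LTree d) (u : ℕ) (i : Fin d) :
    sibCost w T u i = ∑ l ∈ ((univ.filter fun j => T.lab u j = T.lab u i).image (T.lab (u - 1))).erase
      (T.lab (u - 1) i), |blockSum w T (u - 1) l| := by
  unfold sibCost nodeBias
  rw [sum_erase_eq_sub (lab_mem_children T u i)]

/-- Sibling costs are nonnegative. [folklore] -/
theorem sibCost_nonneg (w : Fin d → ℤ) (T : LTree d) (u : ℕ) (i : Fin d) : 0 ≤ sibCost w T u i := by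
  rw [sibCost_eq]; exact sum_nonneg fun _ _ => abs_nonneg _

/-- Sibling cost is at most the node bias. [folklore] -/
theorem sibCost_le_nodeBias (w : Fin d → ℤ) (T : LTree d) (u : ℕ) (i : Fin d) :
    sibCost w T u i ≤ nodeBias w T u i :=
  sub_le_self _ (abs_nonneg _)

/-- The **path cost** of leaf `i` up to level `Δ`: the accumulated sibling costs along the path from the leaf to
its level-`Δ` node. [cite: LimayeSrinivasanTavenas2022, Def. 2] -/
def pathCost (w : Fin d → ℤ) (T : LTree d) (Δ : ℕ) (i : Fin d) : ℤ :=
  ∑ u ∈ Icc 1 Δ, sibCost w T u i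

/-- Path costs are nonnegative. [folklore] -/
theorem pathCost_nonneg (w : Fin d → ℤ) (T : LTree d) (Δ : ℕ) (i : Fin d) : 0 ≤ pathCost w T Δ i :=
  sum_nonneg fun u _ => sibCost_nonneg w T u i

/-- Path cost at depth `0` is `0`. [folklore] -/
theorem pathCost_zero (w : Fin d → ℤ) (T : LTree d) (i : Fin d) : pathCost w T 0 i = 0 := by
  simp [pathCost]

/-- One more level adds one sibling cost. [folklore] -/
theorem pathCost_succ (w : Fin d → ℤ) (T : LTree d) (Δ : ℕ) (i : Fin d) :
    pathCost w T (Δ + 1) i = pathCost w T Δ i + sibCost w T (Δ + 1) i := by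
  unfold pathCost
  exact sum_Icc_succ_top (by omega) _

/-- **Exact path-bias bookkeeping (LST Prop. 17).**  The off-path cost of the internal path from the root (level
`Δ`) down to the level-`t` node of leaf `i` is the node bias of that end node plus the sibling costs of `i` at the
levels `t < u ≤ Δ`. [cite: LimayeSrinivasanTavenas2022, Prop. 17] -/
theorem offCost_eq_nodeBias_add (w : Fin d → ℤ) (T : LTree d) {Δ t : ℕ} (ht : t ≤ Δ) (i : Fin d) :
    offCost w T Δ t i = nodeBias w T t i + ∑ u ∈ Ioc t Δ, sibCost w T u i := by
  unfold offCost
  rw [← Ioc_insert_left ht, sum_insert (by simp)]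
  congr 1
  · unfold nodeBias
    exact sum_congr (filter_true_of_mem fun l _ => Or.inl rfl) fun _ _ => rfl
  · refine sum_congr rfl fun u hu => ?_
    have hut : u ≠ t := by have := (mem_Ioc.1 hu).1; omega
    rw [sibCost_eq]
    refine sum_congr ?_ fun _ _ => rfl
    ext l
    simp only [mem_filter, mem_erase, hut, false_or]
    exact and_comm

/-- Hence the bias of any internal path ending at `i`'s level-`t` node is at most that node's bias plus the full
path cost of `i`. [cite: LimayeSrinivasanTavenas2022, Prop. 17] -/
theorem offCost_le_nodeBias_add_pathCost (w : Fin d → ℤ) (T : LTree d) {Δ t : ℕ} (ht : t ≤ Δ) (i : Fin d) :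
    offCost w T Δ t i ≤ nodeBias w T t i + pathCost w T Δ i := by
  rw [offCost_eq_nodeBias_add w T ht i]
  unfold pathCost
  gcongr with u hu
  · exact fun u _ _ => sibCost_nonneg w T u i
  · intro u hu
    rw [mem_Ioc] at hu
    rw [mem_Icc]; omega

/-! ### Low-path trees -/

/-- A **low-path tree** of depth `Δ`, node-bias bound `β` and per-leaf path budgets `γ`: level `Δ` is a single
block, every internal node at levels `1 … Δ` has node bias `≤ β`, and the path cost of leaf `i` is `≤ γ i`.
[cite: LimayeSrinivasanTavenas2022, Def. 2, Def. 15] -/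
def LowPathTree (w : Fin d → ℤ) (Δ : ℕ) (β : ℤ) (γ : Fin d → ℤ) : Prop :=
  ∃ T : LTree d, (∀ i j, T.lab Δ i = T.lab Δ j) ∧ (∀ u, 1 ≤ u → u ≤ Δ → ∀ i, nodeBias w T u i ≤ β) ∧
    ∀ i, pathCost w T Δ i ≤ γ i

/-- A low-path tree is a low-bias tree. [folklore] -/
theorem LowPathTree.lowBiasTree {w : Fin d → ℤ} {Δ : ℕ} {β : ℤ} {γ : Fin d → ℤ} (h : LowPathTree w Δ β γ) :
    LowBiasTree w Δ β := by
  obtain ⟨T, hroot, hnb, -⟩ := h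
  exact ⟨T, hroot, hnb⟩

/-- Monotonicity in the bounds. [folklore] -/
theorem LowPathTree.mono {w : Fin d → ℤ} {Δ : ℕ} {β β' : ℤ} {γ γ' : Fin d → ℤ} (h : LowPathTree w Δ β γ)
    (hβ : β ≤ β') (hγ : ∀ i, γ i ≤ γ' i) : LowPathTree w Δ β' γ' := by
  obtain ⟨T, hroot, hnb, hpc⟩ := h
  exact ⟨T, hroot, fun u hu1 hu i => (hnb u hu1 hu i).trans hβ, fun i => (hpc i).trans (hγ i)⟩

/-- **A low-path tree refutes large tree bias**: if node biases are `≤ β`, path costs `≤ G` and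
`β + G < τ + |Σ w|`, then `¬ TreeBiasGe w Δ τ`. [cite: LimayeSrinivasanTavenas2022, Prop. 17] -/
theorem not_treeBiasGe_of_lowPathTree {w : Fin d → ℤ} {Δ : ℕ} {β : ℤ} {γ : Fin d → ℤ}
    (hT : LowPathTree w Δ β γ) {G : ℤ} (hG : ∀ i, γ i ≤ G) {τ : ℕ} (hτ : β + G < τ + |∑ j, w j|) :
    ¬ TreeBiasGe w Δ τ := by
  obtain ⟨T, hroot, hnb, hpc⟩ := hT
  intro hTB
  obtain ⟨t, i, ht1, htΔ, hle⟩ := hTB T hroot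
  have h1 := offCost_le_nodeBias_add_pathCost w T htΔ i
  have h2 := hnb t ht1 htΔ i
  have h3 := hpc i
  have h4 := hG i
  linarith

/-- … and at every larger depth as well (padding, `treeBiasGe_anti_depth`). [cite: LimayeSrinivasanTavenas2022,
Def. 2] -/
theorem not_treeBiasGe_of_lowPathTree_of_le {w : Fin d → ℤ} {Δ : ℕ} {β : ℤ} {γ : Fin d → ℤ}
    (hT : LowPathTree w Δ β γ) (hΔ : 1 ≤ Δ) {G : ℤ} (hG : ∀ i, γ i ≤ G) {τ : ℕ}
    (hτ : β + G < τ + |∑ j, w j|) {Δ' : ℕ} (hle : Δ ≤ Δ') : ¬ TreeBiasGe w Δ' τ :=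
  fun h => not_treeBiasGe_of_lowPathTree hT hG hτ (treeBiasGe_anti_depth hΔ hle h)

/-- **Uniform low-path trees at slope `C`** (conjecture schema, constants `B, c₁`): every word with letters
and total in `[-h, h]` has a low-path tree of depth exactly `C·⌊log₂⌊log₂ d⌋⌋ + c₁` with node biases and path
costs `≤ B·h`.  `LowPathTreesAt 2 B c₁` (some `B, c₁`) is the `ULPB₂` builder's target (NODE-v16 §4b).
[cite: LimayeSrinivasanTavenas2022, Question 1] -/
@[conjecture] def LowPathTreesAt (C B c₁ : ℕ) : Prop :=
  ∀ (d : ℕ) (w : Fin d → ℤ) (h : ℕ), (∀ i, |w i| ≤ h) → |∑ i, w i| ≤ h →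
    LowPathTree w (C * Nat.log 2 (Nat.log 2 d) + c₁) (B * h) fun _ => B * h

/-- **The `ULPB_C` criterion**: uniform low-path trees at slope `C` (`c₁ ≥ 1`) give `UniversalLowTreeBiasAt C`
(with constants `2B, c₁`; larger depths by padding). [cite: LimayeSrinivasanTavenas2022, Question 1, Prop. 17] -/
theorem universalLowTreeBiasAt_of_lowPathTreesAt {C B c₁ : ℕ} (hc₁ : 1 ≤ c₁) (hyp : LowPathTreesAt C B c₁) :
    UniversalLowTreeBiasAt C := by
  refine ⟨2 * B, c₁, fun d w h hw hsum Δ hΔ => ?_⟩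
  refine not_treeBiasGe_of_lowPathTree_of_le (hyp d w h hw hsum) (by omega) (fun _ => le_rfl) ?_ hΔ
  push_cast
  nlinarith [abs_nonneg (∑ j, w j)]

/-! ### The star: depth one -/

/-- **Depth one.**  The star has node bias `‖w‖₁` and charges leaf `i` the path cost `‖w‖₁ − |w i|`.
[cite: LimayeSrinivasanTavenas2022, Def. 2] -/
theorem lowPathTree_one {w : Fin d → ℤ} {β : ℤ} (hw : ∑ i, |w i| ≤ β) :
    LowPathTree w 1 β fun i => (∑ j, |w j|) - |w i| := by
  refine ⟨starTree d, fun i j => by simp [starTree], fun u hu1 hu i => ?_, fun i => ?_⟩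
  · obtain rfl : u = 1 := le_antisymm hu hu1
    rw [nodeBias_one]
    exact le_trans (sum_le_sum_of_subset_of_nonneg (filter_subset _ _) fun j _ _ => abs_nonneg _) hw
  · rw [← zero_add 1, pathCost_succ, pathCost_zero, zero_add, zero_add]
    unfold sibCost
    rw [nodeBias_one, show (1 : ℕ) - 1 = 0 from rfl, (starTree d).leaf, blockSum_zero,
      filter_true_of_mem fun j _ => by simp [starTree]]

/-! ### Substitution with budgets: one round of the builder -/

section substitute

variable {M : ℕ} (c : Fin d → Fin M) (hc : Function.Surjective c)

/-- The own level-`1` block of leaf `i` in the substituted tree is its group; at level `0` its block sum is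
`w i`. [folklore] -/
theorem sibCost_substitute_one (w : Fin d → ℤ) (T' : LTree M) (i : Fin d) :
    sibCost w (LTree.substitute c hc T') 1 i = (∑ j ∈ univ.filter (fun j => c j = c i), |w j|) - |w i| := by
  unfold sibCost
  rw [nodeBias_substitute_one, show (1 : ℕ) - 1 = 0 from rfl, (LTree.substitute c hc T').leaf, blockSum_zero]

/-- Above level `1` the sibling costs of the substituted tree are those of the quotient tree.
[cite: LimayeSrinivasanTavenas2022, Def. 15] -/
theorem sibCost_substitute_succ (w : Fin d → ℤ) (T' : LTree M) {v : ℕ} (hv : 1 ≤ v) (i : Fin d) :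
    sibCost w (LTree.substitute c hc T') (v + 1) i = sibCost (quotWord w c) T' v (c i) := by
  unfold sibCost
  rw [nodeBias_substitute_succ c hc w T' hv, show v + 1 - 1 = v from rfl]
  obtain ⟨v', rfl⟩ : ∃ v', v = v' + 1 := ⟨v - 1, by omega⟩
  rw [show v' + 1 - 1 = v' from rfl, substitute_lab_succ, blockSum_substitute_succ]

/-- **Path costs under substitution**: grouping by `c` charges leaf `i` exactly `mass(c i) − |w i|` at the new
level `1`; above it the path cost is that of `c i` in the quotient tree. [cite: LimayeSrinivasanTavenas2022,
Def. 15, Prop. 17] -/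
theorem pathCost_substitute_succ (w : Fin d → ℤ) (T' : LTree M) (Δ : ℕ) (i : Fin d) :
    pathCost w (LTree.substitute c hc T') (Δ + 1) i =
      ((∑ j ∈ univ.filter (fun j => c j = c i), |w j|) - |w i|) + pathCost (quotWord w c) T' Δ (c i) := by
  induction Δ with
  | zero => rw [pathCost_zero, add_zero, ← zero_add 1, pathCost_succ, pathCost_zero, zero_add, zero_add,
      sibCost_substitute_one]
  | succ Δ ih => rw [pathCost_succ, ih, pathCost_succ, sibCost_substitute_succ c hc w T' (by omega), add_assoc]

/-- **Substitution with budgets (one round of the path-bias builder).**  Group the letters of `w` by an onto map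
`c` into groups of mass `≤ β`; if the quotient word has a low-path tree of depth `Δ`, node biases `≤ β` and
budgets `γ'`, and `mass(c i) − |w i| + γ' (c i) ≤ γ i` for every leaf, then `w` has a low-path tree of depth
`Δ + 1`, node biases `≤ β` and budgets `γ`. [cite: LimayeSrinivasanTavenas2022, Def. 15, Prop. 16, Prop. 17] -/
theorem lowPathTree_succ_of_quotient (hc : Function.Surjective c) {w : Fin d → ℤ} {β : ℤ}
    (hmass : ∀ m, ∑ j ∈ univ.filter (fun j => c j = m), |w j| ≤ β) {Δ : ℕ} {γ' : Fin M → ℤ} {γ : Fin d → ℤ}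
    (hγ : ∀ i, (∑ j ∈ univ.filter (fun j => c j = c i), |w j|) - |w i| + γ' (c i) ≤ γ i)
    (hT' : LowPathTree (quotWord w c) Δ β γ') : LowPathTree w (Δ + 1) β γ := by
  obtain ⟨T', hroot, hnb, hpc⟩ := hT'
  refine ⟨LTree.substitute c hc T', fun i j => ?_, fun u hu1 hu i => ?_, fun i => ?_⟩
  · rw [substitute_lab_succ, substitute_lab_succ, hroot (c i) (c j)]
  · obtain ⟨v, rfl⟩ : ∃ v, u = v + 1 := ⟨u - 1, by omega⟩
    rcases Nat.eq_zero_or_pos v with rfl | hv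
    · rw [nodeBias_substitute_one]; exact hmass (c i)
    · rw [nodeBias_substitute_succ c hc w T' hv]
      exact hnb v hv (by omega) (c i)
  · rw [pathCost_substitute_succ]
    exact le_trans (add_le_add le_rfl (hpc (c i))) (hγ i)

end substitute

end Summit.ValiantsHypothesis.ValiantsHypothesis.Theorems.DepthWindow.TreeBias
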